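import Summits.CriticalPhenomena.SAWScalingLimit.Theses.SAWCompassLattice

/-!
# `Assembly` of route SAWCompassLattice (item stmt-CriticalPhenomena-6969)

The assembly item of route `SAWCompassLattice` (sub-problem `SAWScalingLimit`):
`CompassRealisation → CompassEndpoints → CompassSLE → SurfaceUniversality → SAWScalingLimit`.
This is pure logic plus the two-ε limit algebra already carried out by the route's deciding
theorem `closes` (same file): fix a Dobrushin domain `D` and a `ℤ²` endpoint approximation
`(a, b)`; take a solution `(α, β, s, z)` of the compass equations (`CompassRealisation`) and port
endpoint approximations `(a', b')` of `D` (`CompassEndpoints`); `CompassSLE` yields an `SLE(8/3)`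
random curve `Γ` with `∫ f d(compass law)_δ → E f(Γ)` for every bounded continuous `f`;
`SurfaceUniversality` gives `∫ f ∘ curve dP^{ℤ²}_δ − ∫ f d(compass law)_δ → 0`; adding the two
limits gives `TendstoLaw` for the `ℤ²` law, and a.e.-measurability is `SAW.aemeasurable_curve`.
-/

namespace Summit.CriticalPhenomena.SAWScalingLimit.Theorems

open Summit.CriticalPhenomena.SAWScalingLimit.Theses.SAWCompassLattice

/-- **Assembly of route SAWCompassLattice** (item stmt-CriticalPhenomena-6969): the four cruxes
`CompassRealisation`, `CompassEndpoints`, `CompassSLE`, `SurfaceUniversality` imply the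
sub-problem statement `SAWScalingLimit` — by the route's deciding theorem `closes` (two-ε
argument). -/
theorem sawCompassLattice_assembly_proof :
    Summit.CriticalPhenomena.SAWScalingLimit.Theses.SAWCompassLattice.Assembly := by
  unfold Assembly
  exact fun hR hE hS hU => closes hR hE hS hU

end Summit.CriticalPhenomena.SAWScalingLimit.Theorems
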